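import Literature.NumberTheory.Rogawski1990.ArchBouazizWallPlaceRepresentation    -- ★ p851023 (LH3-p01 (g4)): (S4a); brings ★ (α4-S2) `exists_clm_ambient_endoEmbArch_update`, ★ p850992 model package, ★ `endoBlock_eq_cayleyTorus_of_not_mem`, ★ `coe_cayleyTorus_eq_smul`
import HarnessLib

/-!
# THE WALL-SET READING OF THE MODEL'S INTEGRAND: the ambient matrix is affine in ANY finite set of place blocks, and at a set `P₀` of compact places the integrand is ONE jointly smooth
# function of (outer leaf data, coordinates, conjugated Cayley torus matrices) (stage (α4-S7a), part 1, of `ALPHA4-DESIGN.v1.md`; Rogawski 1990 §4.8, §8.2; Varadarajan 1989 §6.4)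

Topic `NumberTheory/Rogawski1990`; namespace `Literature.NumberTheory.Rogawski1990`.  THEOREMS ONLY (no `def`, no instance, no axiom, no `sorry`).  Cell `pub/hodgecm-mathlib`,
crux H413 (`stmt-HodgeConjecture-24833`), line LH3 (closer stub `stub_N9`, DIRECT ROAD), organ O-L3′ conjunct (ii) pay-down for GENERAL `fH` (`h2` of ★ `archBzSmoothBounded_stOrbFamH_of_slab_zero`).
Author LH3-p01 (g5).  Count-neutral.

WHAT.  ★ (α4-S4a) `apply_symm_update_conj_eq_ambient` reads the model's integrand at ONE wall place; a base point of `K ∩ slab₀` may sit on several compact walls at once (`|P₀| ≥ 2`), and the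
`k`-fold engine (LH10-p01's `Inv ι`, (α4-S6)) eats a jointly smooth `Φ : V × (ι → M₂(ℂ)) → E`.  This file supplies the multi-place bookkeeping:
* §1 **`exists_clm_ambient_endoEmbArch_update_finset`** — ONE family `Λ_w : M₂(ℂ) →L[ℝ] M₃(L ⊗ ℝ)` of injective linear maps (★ (α4-S2), chosen once for all `w`) with, for EVERY finite set
  `P` of places, `↑↑ι_∞(eA⁻¹ [w ∈ P ? Y_w : G_w], b) = ↑↑ι_∞(eA⁻¹ G, b) + Σ_{w ∈ P} Λ_w(↑↑Y_w − ↑↑G_w)` (Finset induction on `P`; the update at `P = univ`: `exists_clm_ambient_endoEmbArch_sub_eq_sum`).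
* §2 **`coe_conj_endoBlockAt_eq_smul`** — at a compact place `w ∉ S`, for every integer `m`: `↑↑(h γ_w(c) h⁻¹) = e^{i((c_w0+c_w2)/2 + mπ)} • ↑↑(h · P t_1(ψ) P⁻¹ · h⁻¹)`,
  `ψ = (c_w0 − c_w2)/2 − mπ` (★ `endoBlock_eq_cayleyTorus_of_not_mem`, ★ `coe_cayleyTorus_eq_smul`); `contDiff_coe_endoBlock` (the block matrix is `C^∞` in `c`), `contDiff_wallCentre`.
* §3 **`contDiff_wallSetAmbientModel`** — the model `Φ♭((A_w, B_w)_w, (c, Y)) = Θ(↑↑ι_∞(γ_S(c)) + Σ_{i ∈ P₀} Λ_i(u_i(c) • Y_i − ↑↑γ_i(c)) + Σ_{w ∉ P₀} Λ_w(A_w ↑↑γ_w(c) B_w − ↑↑γ_w(c)))` is jointly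
  `C^∞` (★ `contDiff_coe_endoEmbArch_endoTorus`, §2); **`apply_symm_wallSet_conj_eq_ambientModel`** — the model's integrand with the `P₀`-blocks conjugated by `h` and the other blocks by
  the leaves `z′` IS `Φ♭` at `((↑↑z′_{w,1}, ↑↑(z′_{w,2} z′_{w,1}⁻¹))_w, (c, (↑↑(h_i · P t_1(ψ_i(c)) P⁻¹ · h_i⁻¹))_i))`.
HONEST LABEL: HC_CM is proved only modulo the 7 printed citations (2 remaining: hLiu418 = stmt-HodgeConjecture-24832, h413 = stmt-HodgeConjecture-24833) until rung 0 closes; bookkeeping,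
pays nothing by itself.

## References
* [Rogawski1990] J. D. Rogawski, *Automorphic Representations of Unitary Groups in Three Variables*, Ann. of Math. Stud. 123 (1990), §4.8 p. 53; §8.2 pp. 119–122.
* [Varadarajan1989] V. S. Varadarajan, *An Introduction to Harmonic Analysis on Semisimple Lie Groups*, Cambridge Stud. Adv. Math. 16 (1989), §6.4 Lemma 21, Thms 22–23.
* [BorelJacquet1979] A. Borel, H. Jacquet, *Automorphic forms and automorphic representations*, Proc. Sympos. Pure Math. 33.1 (1979), §4.1.
-/

set_option autoImplicit false

noncomputable section

open MeasureTheory Measure Filter Topology Set Function NumberField NumberField.InfinitePlace NumberField.mixedEmbedding Matrix Complex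
open Literature.NumberTheory.Automorphic Literature.NumberTheory.Automorphic.UnitaryGroup Literature.NumberTheory.Automorphic.ArchCartan
open scoped ContDiff MatrixGroups Matrix Classical
open scoped Matrix.Norms.Operator

namespace Literature.NumberTheory.Rogawski1990

local notation3 "Φ₂[" L "]" => (Matrix.of fun i j : Fin 2 => if i.val + j.val + 1 = 2 then (1 : L) else 0)
local notation3 "Φ₁[" L "]" => (Matrix.of fun i j : Fin 1 => if i.val + j.val + 1 = 1 then (1 : L) else 0)
local notation3 "𝔸[" L "]" => ↥(arch (↥(maximalRealSubfield L)) L (IsCMField.complexConj L) 2 Φ₂[L])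
local notation3 "𝔹[" L "]" => ↥(arch (↥(maximalRealSubfield L)) L (IsCMField.complexConj L) 1 Φ₁[L])

/-! ## §1 The ambient matrix is affine in any finite set of place blocks -/

section Update

variable (L : Type) [Field L] [NumberField L] [IsCMField L]

/-- **MULTI-PLACE UPDATE**: one family of injective `ℝ`-linear `Λ_w : M₂(ℂ) →L[ℝ] M₃(L ⊗ ℝ)` (★ (α4-S2) at every `w`) such that for EVERY finite set `P` of complex places, replacing the
blocks of `G` at the places of `P` by those of `Y` changes `↑↑ι_∞(eA⁻¹ G, b)` by `Σ_{w ∈ P} Λ_w(↑↑Y_w − ↑↑G_w)` (Finset induction: the replacement at `insert a P` is the update at `a` of the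
replacement at `P`). [cite: Rogawski1990, §4.8 Case (a) p. 53] [cite: BorelJacquet1979, §4.1] -/
theorem exists_clm_ambient_endoEmbArch_update_finset :
    ∃ Λ : {w : InfinitePlace L // IsComplex w} → (Matrix (Fin 2) (Fin 2) ℂ →L[ℝ] Matrix (Fin 3) (Fin 3) (mixedSpace L)), (∀ w, Injective (Λ w)) ∧
      ∀ (P : Finset {w : InfinitePlace L // IsComplex w}) (G Y : ∀ w : {w : InfinitePlace L // IsComplex w}, ↥(archLocal L 2 Φ₂[L] w)) (b : 𝔹[L]),
        (((endoEmbArch L ((archPiEquivCM 2 L Φ₂[L]).symm (fun w => if w ∈ P then Y w else G w), b)).val : GL (Fin 3) (mixedSpace L)) :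
            Matrix (Fin 3) (Fin 3) (mixedSpace L)) =
          (((endoEmbArch L ((archPiEquivCM 2 L Φ₂[L]).symm G, b)).val : GL (Fin 3) (mixedSpace L)) : Matrix (Fin 3) (Fin 3) (mixedSpace L)) +
            ∑ w ∈ P, Λ w ((((Y w : ↥(archLocal L 2 Φ₂[L] w)) : GL (Fin 2) ℂ) : Matrix (Fin 2) (Fin 2) ℂ) - (((G w : ↥(archLocal L 2 Φ₂[L] w)) : GL (Fin 2) ℂ) : Matrix (Fin 2) (Fin 2) ℂ)) := by
  classical
  choose Λ hΛi hΛ using fun w : {w : InfinitePlace L // IsComplex w} => exists_clm_ambient_endoEmbArch_update L w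
  refine ⟨Λ, hΛi, fun P => ?_⟩
  induction P using Finset.induction_on with
  | empty =>
    intro G Y b
    simp only [Finset.sum_empty, add_zero]
    rfl
  | insert a P ha ih =>
    intro G Y b
    have hupd : (fun w => if w ∈ insert a P then Y w else G w) = Function.update (fun w => if w ∈ P then Y w else G w) a (Y a) := by
      funext w
      by_cases hw : w = a
      · subst hw
        rw [Function.update_self, if_pos (Finset.mem_insert_self _ _)]
      · rw [Function.update_of_ne hw]
        simp only [Finset.mem_insert, hw, false_or]
    rw [hupd, hΛ a, ih G Y b, Finset.sum_insert ha]
    simp only [if_neg ha]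
    abel

/-- **The difference of two ambient matrices is the sum of the block updates** (§1 at `P = univ`): `↑↑ι_∞(eA⁻¹ Y, b) = ↑↑ι_∞(eA⁻¹ G, b) + Σ_w Λ_w(↑↑Y_w − ↑↑G_w)`.
[cite: Rogawski1990, §4.8 Case (a) p. 53] [cite: BorelJacquet1979, §4.1] -/
theorem exists_clm_ambient_endoEmbArch_sub_eq_sum :
    ∃ Λ : {w : InfinitePlace L // IsComplex w} → (Matrix (Fin 2) (Fin 2) ℂ →L[ℝ] Matrix (Fin 3) (Fin 3) (mixedSpace L)), (∀ w, Injective (Λ w)) ∧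
      ∀ (G Y : ∀ w : {w : InfinitePlace L // IsComplex w}, ↥(archLocal L 2 Φ₂[L] w)) (b : 𝔹[L]),
        (((endoEmbArch L ((archPiEquivCM 2 L Φ₂[L]).symm Y, b)).val : GL (Fin 3) (mixedSpace L)) : Matrix (Fin 3) (Fin 3) (mixedSpace L)) =
          (((endoEmbArch L ((archPiEquivCM 2 L Φ₂[L]).symm G, b)).val : GL (Fin 3) (mixedSpace L)) : Matrix (Fin 3) (Fin 3) (mixedSpace L)) +
            ∑ w, Λ w ((((Y w : ↥(archLocal L 2 Φ₂[L] w)) : GL (Fin 2) ℂ) : Matrix (Fin 2) (Fin 2) ℂ) - (((G w : ↥(archLocal L 2 Φ₂[L] w)) : GL (Fin 2) ℂ) : Matrix (Fin 2) (Fin 2) ℂ)) := by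
  obtain ⟨Λ, hΛi, hΛ⟩ := exists_clm_ambient_endoEmbArch_update_finset L
  refine ⟨Λ, hΛi, fun G Y b => ?_⟩
  have h := hΛ Finset.univ G Y b
  simpa only [Finset.mem_univ, if_true] using h

end Update

/-! ## §2 The Cayley-centre reading of a conjugate at a compact place; the block matrix and the centre are smooth in the coordinates -/

section Compact

variable (L : Type) [Field L] [NumberField L] [IsCMField L] (S : Finset {w : InfinitePlace L // IsComplex w}) (w : {w : InfinitePlace L // IsComplex w})

omit [NumberField L] [IsCMField L] in
/-- **`↑↑(h γ_w(c) h⁻¹) = e^{i((c_w0+c_w2)/2 + mπ)} • ↑↑(h · P t_1(ψ) P⁻¹ · h⁻¹)`**, `ψ = (c_w0 − c_w2)/2 − mπ`, at a compact place `w ∉ S`, for every integer `m`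
(★ `endoBlock_eq_cayleyTorus_of_not_mem`: `γ_w(c) = P t_u(ψ) P⁻¹`; ★ `coe_cayleyTorus_eq_smul`: `t_u = u · t_1`). [cite: Rogawski1990, §8.2 p. 122] [cite: Varadarajan1989, §6.4 Lemma 21] -/
theorem coe_conj_endoBlockAt_eq_smul (hw : w ∉ S) (c : {w : InfinitePlace L // IsComplex w} → Fin 3 → ℝ) (m : ℤ) (h : ↥(archLocal L 2 Φ₂[L] w)) :
    (((h * endoBlockAt L S w (c w) * h⁻¹ : ↥(archLocal L 2 Φ₂[L] w)) : GL (Fin 2) ℂ) : Matrix (Fin 2) (Fin 2) ℂ) =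
      ((Circle.exp ((c w 0 + c w 2) / 2 + m * Real.pi) : Circle) : ℂ) •
        (((h * ⟨Matrix.GeneralLinearGroup.mkOfDetNeZero !![(1 : ℂ), 1; 1, -1] det_cayleyTwo_ne_zero *
            circleDiagonal 2 ![1 * Circle.exp ((c w 0 - c w 2) / 2 - m * Real.pi), 1 * Circle.exp (-((c w 0 - c w 2) / 2 - m * Real.pi))] *
            (Matrix.GeneralLinearGroup.mkOfDetNeZero !![(1 : ℂ), 1; 1, -1] det_cayleyTwo_ne_zero)⁻¹, cayley_conj_circleDiagonal_mem_archLocal L w _⟩ * h⁻¹ :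
          ↥(archLocal L 2 Φ₂[L] w)) : GL (Fin 2) ℂ) : Matrix (Fin 2) (Fin 2) ℂ) := by
  have hγ : endoBlockAt L S w (c w) = ⟨Matrix.GeneralLinearGroup.mkOfDetNeZero !![(1 : ℂ), 1; 1, -1] det_cayleyTwo_ne_zero *
      circleDiagonal 2 ![Circle.exp ((c w 0 + c w 2) / 2 + m * Real.pi) * Circle.exp ((c w 0 - c w 2) / 2 - m * Real.pi),
        Circle.exp ((c w 0 + c w 2) / 2 + m * Real.pi) * Circle.exp (-((c w 0 - c w 2) / 2 - m * Real.pi))] *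
      (Matrix.GeneralLinearGroup.mkOfDetNeZero !![(1 : ℂ), 1; 1, -1] det_cayleyTwo_ne_zero)⁻¹, cayley_conj_circleDiagonal_mem_archLocal L w _⟩ := by
    rw [← endoBlock_eq_endoBlockAt]
    exact endoBlock_eq_cayleyTorus_of_not_mem L S w hw c m
  rw [hγ]
  show ((((h : ↥(archLocal L 2 Φ₂[L] w)) : GL (Fin 2) ℂ) * (Matrix.GeneralLinearGroup.mkOfDetNeZero !![(1 : ℂ), 1; 1, -1] det_cayleyTwo_ne_zero *
      circleDiagonal 2 ![Circle.exp ((c w 0 + c w 2) / 2 + m * Real.pi) * Circle.exp ((c w 0 - c w 2) / 2 - m * Real.pi),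
        Circle.exp ((c w 0 + c w 2) / 2 + m * Real.pi) * Circle.exp (-((c w 0 - c w 2) / 2 - m * Real.pi))] *
      (Matrix.GeneralLinearGroup.mkOfDetNeZero !![(1 : ℂ), 1; 1, -1] det_cayleyTwo_ne_zero)⁻¹) * ((h : ↥(archLocal L 2 Φ₂[L] w)) : GL (Fin 2) ℂ)⁻¹ : GL (Fin 2) ℂ) :
      Matrix (Fin 2) (Fin 2) ℂ) =
    ((Circle.exp ((c w 0 + c w 2) / 2 + m * Real.pi) : Circle) : ℂ) •
      ((((h : ↥(archLocal L 2 Φ₂[L] w)) : GL (Fin 2) ℂ) * (Matrix.GeneralLinearGroup.mkOfDetNeZero !![(1 : ℂ), 1; 1, -1] det_cayleyTwo_ne_zero *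
          circleDiagonal 2 ![1 * Circle.exp ((c w 0 - c w 2) / 2 - m * Real.pi), 1 * Circle.exp (-((c w 0 - c w 2) / 2 - m * Real.pi))] *
          (Matrix.GeneralLinearGroup.mkOfDetNeZero !![(1 : ℂ), 1; 1, -1] det_cayleyTwo_ne_zero)⁻¹) * ((h : ↥(archLocal L 2 Φ₂[L] w)) : GL (Fin 2) ℂ)⁻¹ : GL (Fin 2) ℂ) :
        Matrix (Fin 2) (Fin 2) ℂ)
  exact coe_conj_eq_smul_of_coe_eq_smul (coe_cayleyTorus_eq_smul (Circle.exp ((c w 0 + c w 2) / 2 + m * Real.pi)) ((c w 0 - c w 2) / 2 - m * Real.pi))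

omit [IsCMField L] in
/-- **The block matrix `↑↑γ_w(c)` is `C^∞` in the coordinates** (entrywise ★ `contDiff_coe_endoBlock_apply`, through the linear `Matrix.of`). [cite: Rogawski1990, §8.2 p. 122] -/
theorem contDiff_coe_endoBlock : ContDiff ℝ ∞ fun c : {w : InfinitePlace L // IsComplex w} → Fin 3 → ℝ => ((endoBlock L S c w : GL (Fin 2) ℂ) : Matrix (Fin 2) (Fin 2) ℂ) := by
  let Λ : (Fin 2 → Fin 2 → ℂ) →L[ℝ] Matrix (Fin 2) (Fin 2) ℂ :=
    LinearMap.toContinuousLinearMap ((Matrix.ofLinearEquiv ℝ : (Fin 2 → Fin 2 → ℂ) ≃ₗ[ℝ] Matrix (Fin 2) (Fin 2) ℂ).toLinearMap)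
  have hΛ : ∀ f : Fin 2 → Fin 2 → ℂ, Λ f = Matrix.of f := fun _ => rfl
  have hfun : (fun c : {w : InfinitePlace L // IsComplex w} → Fin 3 → ℝ => ((endoBlock L S c w : GL (Fin 2) ℂ) : Matrix (Fin 2) (Fin 2) ℂ)) =
      fun c => Λ fun i j => ((endoBlock L S c w : GL (Fin 2) ℂ) : Matrix (Fin 2) (Fin 2) ℂ) i j := by
    funext c; rw [hΛ]; rfl
  rw [hfun]
  exact Λ.contDiff.comp (contDiff_pi.2 fun i => contDiff_pi.2 fun j => contDiff_coe_endoBlock_apply L S w i j)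

omit [IsCMField L] in
/-- **The centre `e^{i((c_w0+c_w2)/2 + mπ)}` is `C^∞` in the coordinates** (as a complex number). [cite: Rogawski1990, §8.2 p. 122] -/
theorem contDiff_wallCentre (m : ℤ) :
    ContDiff ℝ ∞ fun c : {w : InfinitePlace L // IsComplex w} → Fin 3 → ℝ => ((Circle.exp ((c w 0 + c w 2) / 2 + m * Real.pi) : Circle) : ℂ) := by
  have h : (fun c : {w : InfinitePlace L // IsComplex w} → Fin 3 → ℝ => ((Circle.exp ((c w 0 + c w 2) / 2 + m * Real.pi) : Circle) : ℂ)) =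
      fun c => Complex.exp ((((c w 0 + c w 2) / 2 + m * Real.pi : ℝ) : ℂ) * I) := funext fun c => by rw [Circle.coe_exp]
  rw [h]
  refine Complex.contDiff_exp.comp ((ofRealCLM.contDiff.comp ?_).mul contDiff_const)
  exact (((contDiff_apply_apply ℝ ℝ w 0).add (contDiff_apply_apply ℝ ℝ w 2)).div_const 2).add contDiff_const

end Compact

/-! ## §3 The jointly smooth ambient model of the integrand at a wall set `P₀`, and the reading identity -/

section Model

variable (L : Type) [Field L] [NumberField L] [IsCMField L] (S P₀ : Finset {w : InfinitePlace L // IsComplex w}) (m : {w : InfinitePlace L // IsComplex w} → ℤ)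

/-- **THE AMBIENT MODEL IS JOINTLY `C^∞`**: for `Θ` `C^∞` on `M₃(L ⊗ ℝ)` and continuous linear `Λ_w`,
`Φ♭((A_w, B_w)_w, (c, Y)) = Θ(↑↑ι_∞(γ_S(c)) + Σ_{i ∈ P₀} Λ_i(u_i(c) • Y_i − ↑↑γ_i(c)) + Σ_{w ∉ P₀} Λ_w(A_w · ↑↑γ_w(c) · B_w − ↑↑γ_w(c)))` is `C^∞` in all its variables
(★ `contDiff_coe_endoEmbArch_endoTorus`, §2, products in `M₂(ℂ)`). [cite: Varadarajan1989, §6.4 Thm 23] [cite: Rogawski1990, §8.2 p. 122] -/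
theorem contDiff_wallSetAmbientModel {Θ : Matrix (Fin 3) (Fin 3) (mixedSpace L) → ℂ} (hΘ : ContDiff ℝ ∞ Θ)
    (Λ : {w : InfinitePlace L // IsComplex w} → (Matrix (Fin 2) (Fin 2) ℂ →L[ℝ] Matrix (Fin 3) (Fin 3) (mixedSpace L))) :
    ContDiff ℝ ∞ fun q : ({w : InfinitePlace L // IsComplex w} → Matrix (Fin 2) (Fin 2) ℂ × Matrix (Fin 2) (Fin 2) ℂ) ×
        (({w : InfinitePlace L // IsComplex w} → Fin 3 → ℝ) × (↥P₀ → Matrix (Fin 2) (Fin 2) ℂ)) =>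
      Θ ((((endoEmbArch L (endoTorus L S q.2.1)).val : GL (Fin 3) (mixedSpace L)) : Matrix (Fin 3) (Fin 3) (mixedSpace L)) +
        ∑ i : ↥P₀, Λ i.1 ((((Circle.exp ((q.2.1 i.1 0 + q.2.1 i.1 2) / 2 + m i.1 * Real.pi) : Circle) : ℂ) • q.2.2 i : Matrix (Fin 2) (Fin 2) ℂ) -
          ((endoBlock L S q.2.1 i.1 : GL (Fin 2) ℂ) : Matrix (Fin 2) (Fin 2) ℂ)) +
        ∑ w ∈ Finset.univ.filter (fun w => w ∉ P₀), Λ w ((q.1 w).1 * ((endoBlock L S q.2.1 w : GL (Fin 2) ℂ) : Matrix (Fin 2) (Fin 2) ℂ) * (q.1 w).2 -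
          ((endoBlock L S q.2.1 w : GL (Fin 2) ℂ) : Matrix (Fin 2) (Fin 2) ℂ))) := by
  have hc : ContDiff ℝ ∞ fun q : ({w : InfinitePlace L // IsComplex w} → Matrix (Fin 2) (Fin 2) ℂ × Matrix (Fin 2) (Fin 2) ℂ) ×
      (({w : InfinitePlace L // IsComplex w} → Fin 3 → ℝ) × (↥P₀ → Matrix (Fin 2) (Fin 2) ℂ)) => q.2.1 := contDiff_fst.comp contDiff_snd
  have hγ : ∀ w, ContDiff ℝ ∞ fun q : ({w : InfinitePlace L // IsComplex w} → Matrix (Fin 2) (Fin 2) ℂ × Matrix (Fin 2) (Fin 2) ℂ) ×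
      (({w : InfinitePlace L // IsComplex w} → Fin 3 → ℝ) × (↥P₀ → Matrix (Fin 2) (Fin 2) ℂ)) => ((endoBlock L S q.2.1 w : GL (Fin 2) ℂ) : Matrix (Fin 2) (Fin 2) ℂ) :=
    fun w => (contDiff_coe_endoBlock L S w).comp hc
  refine hΘ.comp ((((contDiff_coe_endoEmbArch_endoTorus L S).comp hc).add (ContDiff.sum fun i _ => (Λ i.1).contDiff.comp ?_)).add
    (ContDiff.sum fun w _ => (Λ w).contDiff.comp ?_))
  · have hu : ContDiff ℝ ∞ fun q : ({w : InfinitePlace L // IsComplex w} → Matrix (Fin 2) (Fin 2) ℂ × Matrix (Fin 2) (Fin 2) ℂ) ×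
        (({w : InfinitePlace L // IsComplex w} → Fin 3 → ℝ) × (↥P₀ → Matrix (Fin 2) (Fin 2) ℂ)) =>
        ((Circle.exp ((q.2.1 i.1 0 + q.2.1 i.1 2) / 2 + m i.1 * Real.pi) : Circle) : ℂ) := (contDiff_wallCentre L i.1 (m i.1)).comp hc
    have hY : ContDiff ℝ ∞ fun q : ({w : InfinitePlace L // IsComplex w} → Matrix (Fin 2) (Fin 2) ℂ × Matrix (Fin 2) (Fin 2) ℂ) ×
        (({w : InfinitePlace L // IsComplex w} → Fin 3 → ℝ) × (↥P₀ → Matrix (Fin 2) (Fin 2) ℂ)) => q.2.2 i :=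
      (contDiff_apply ℝ (Matrix (Fin 2) (Fin 2) ℂ) i).comp (contDiff_snd.comp contDiff_snd)
    exact (hu.smul hY).sub (hγ i.1)
  · have h1 : ContDiff ℝ ∞ fun q : ({w : InfinitePlace L // IsComplex w} → Matrix (Fin 2) (Fin 2) ℂ × Matrix (Fin 2) (Fin 2) ℂ) ×
        (({w : InfinitePlace L // IsComplex w} → Fin 3 → ℝ) × (↥P₀ → Matrix (Fin 2) (Fin 2) ℂ)) => q.1 w :=
      (contDiff_apply ℝ (Matrix (Fin 2) (Fin 2) ℂ × Matrix (Fin 2) (Fin 2) ℂ) w).comp contDiff_fst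
    exact (((contDiff_fst.comp h1).mul (hγ w)).mul (contDiff_snd.comp h1)).sub (hγ w)

/-- **THE READING IDENTITY AT A WALL SET**: for `fH = Θ ∘ ↑↑ι_∞`, `Λ_w` with the difference formula of §1, `P₀ ⊆ Sᶜ`, leaves `z′` at the places off `P₀`, `h ∈ Π_{P₀} U(Φ₂)_w` and every `c`,
the model's integrand at the point `eA⁻¹(w ↦ [w ∈ P₀ ? h_w γ_w(c) h_w⁻¹ : z′_{w,1} γ_w(c) z′_{w,2} z′_{w,1}⁻¹])`, `b = b(c)`, IS the ambient model `Φ♭` of `contDiff_wallSetAmbientModel` at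
`(AB, (c, (↑↑(h_i · P t_1(ψ_i(c)) P⁻¹ · h_i⁻¹))_i))` for ANY `AB` with `AB_w = (↑↑z′_{w,1}, ↑↑(z′_{w,2} z′_{w,1}⁻¹))` at `w ∉ P₀`, `ψ_i(c) = (c_i0 − c_i2)/2 − m_iπ` (§1 at `G := γ_S(c)`, §2 at
the places of `P₀`).
[cite: Rogawski1990, §4.8 p. 53; §8.2 p. 122] [cite: Varadarajan1989, §6.4 Lemma 21] -/
theorem apply_symm_wallSet_conj_eq_ambientModel (hP₀ : ∀ w ∈ P₀, w ∉ S) {fH : 𝔸[L] × 𝔹[L] → ℂ} {Θ : Matrix (Fin 3) (Fin 3) (mixedSpace L) → ℂ}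
    (hΘf : ∀ k, fH k = Θ (((endoEmbArch L k).val : GL (Fin 3) (mixedSpace L)) : Matrix (Fin 3) (Fin 3) (mixedSpace L)))
    (Λ : {w : InfinitePlace L // IsComplex w} → (Matrix (Fin 2) (Fin 2) ℂ →L[ℝ] Matrix (Fin 3) (Fin 3) (mixedSpace L)))
    (hΛ : ∀ (G Y : ∀ w : {w : InfinitePlace L // IsComplex w}, ↥(archLocal L 2 Φ₂[L] w)) (b : 𝔹[L]),
      (((endoEmbArch L ((archPiEquivCM 2 L Φ₂[L]).symm Y, b)).val : GL (Fin 3) (mixedSpace L)) : Matrix (Fin 3) (Fin 3) (mixedSpace L)) =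
        (((endoEmbArch L ((archPiEquivCM 2 L Φ₂[L]).symm G, b)).val : GL (Fin 3) (mixedSpace L)) : Matrix (Fin 3) (Fin 3) (mixedSpace L)) +
          ∑ w, Λ w ((((Y w : ↥(archLocal L 2 Φ₂[L] w)) : GL (Fin 2) ℂ) : Matrix (Fin 2) (Fin 2) ℂ) - (((G w : ↥(archLocal L 2 Φ₂[L] w)) : GL (Fin 2) ℂ) : Matrix (Fin 2) (Fin 2) ℂ)))
    (z' : ∀ w : {w : {w : InfinitePlace L // IsComplex w} // w ∉ P₀}, ↥(archLocal L 2 Φ₂[L] w.1) × ↥(archLocal L 2 Φ₂[L] w.1))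
    (AB : {w : InfinitePlace L // IsComplex w} → Matrix (Fin 2) (Fin 2) ℂ × Matrix (Fin 2) (Fin 2) ℂ)
    (hAB : ∀ (w) (hw : w ∉ P₀), AB w = (((((z' ⟨w, hw⟩).1 : ↥(archLocal L 2 Φ₂[L] w)) : GL (Fin 2) ℂ) : Matrix (Fin 2) (Fin 2) ℂ),
      ((((z' ⟨w, hw⟩).2 * ((z' ⟨w, hw⟩).1)⁻¹ : ↥(archLocal L 2 Φ₂[L] w)) : GL (Fin 2) ℂ) : Matrix (Fin 2) (Fin 2) ℂ)))
    (h : ∀ i : ↥P₀, ↥(archLocal L 2 Φ₂[L] i.1)) (c : {w : InfinitePlace L // IsComplex w} → Fin 3 → ℝ) :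
    fH ((archPiEquivCM 2 L Φ₂[L]).symm (fun w => if hw : w ∈ P₀ then h ⟨w, hw⟩ * endoBlockAt L S w (c w) * (h ⟨w, hw⟩)⁻¹
        else (z' ⟨w, hw⟩).1 * (endoBlockAt L S w (c w) * (z' ⟨w, hw⟩).2) * (z' ⟨w, hw⟩).1⁻¹), (endoTorus L S c).2) =
      Θ ((((endoEmbArch L (endoTorus L S c)).val : GL (Fin 3) (mixedSpace L)) : Matrix (Fin 3) (Fin 3) (mixedSpace L)) +
        ∑ i : ↥P₀, Λ i.1 ((((Circle.exp ((c i.1 0 + c i.1 2) / 2 + m i.1 * Real.pi) : Circle) : ℂ) •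
            (((h i * ⟨Matrix.GeneralLinearGroup.mkOfDetNeZero !![(1 : ℂ), 1; 1, -1] det_cayleyTwo_ne_zero *
                circleDiagonal 2 ![1 * Circle.exp ((c i.1 0 - c i.1 2) / 2 - m i.1 * Real.pi), 1 * Circle.exp (-((c i.1 0 - c i.1 2) / 2 - m i.1 * Real.pi))] *
                (Matrix.GeneralLinearGroup.mkOfDetNeZero !![(1 : ℂ), 1; 1, -1] det_cayleyTwo_ne_zero)⁻¹, cayley_conj_circleDiagonal_mem_archLocal L i.1 _⟩ * (h i)⁻¹ :
              ↥(archLocal L 2 Φ₂[L] i.1)) : GL (Fin 2) ℂ) : Matrix (Fin 2) (Fin 2) ℂ) : Matrix (Fin 2) (Fin 2) ℂ) -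
          ((endoBlock L S c i.1 : GL (Fin 2) ℂ) : Matrix (Fin 2) (Fin 2) ℂ)) +
        ∑ w ∈ Finset.univ.filter (fun w => w ∉ P₀), Λ w ((AB w).1 * ((endoBlock L S c w : GL (Fin 2) ℂ) : Matrix (Fin 2) (Fin 2) ℂ) * (AB w).2 -
          ((endoBlock L S c w : GL (Fin 2) ℂ) : Matrix (Fin 2) (Fin 2) ℂ))) := by
  classical
  -- the base family is the torus point itself: `eA⁻¹ (γ_S(c)) = (endoTorus c).1`
  have hγ : (archPiEquivCM 2 L Φ₂[L]).symm (fun w => endoBlock L S c w) = (endoTorus L S c).1 := by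
    rw [ContinuousMulEquiv.symm_apply_eq]
    funext w
    exact (archPiEquivCM_endoTorus_fst L S c w).symm
  have hbase : (((endoEmbArch L ((archPiEquivCM 2 L Φ₂[L]).symm (fun w => endoBlock L S c w), (endoTorus L S c).2)).val : GL (Fin 3) (mixedSpace L)) :
      Matrix (Fin 3) (Fin 3) (mixedSpace L)) = (((endoEmbArch L (endoTorus L S c)).val : GL (Fin 3) (mixedSpace L)) : Matrix (Fin 3) (Fin 3) (mixedSpace L)) := by
    rw [hγ]
  rw [hΘf, hΛ (fun w => endoBlock L S c w), hbase]
  congr 1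
  -- split the sum over all places into `P₀` and its complement
  rw [add_assoc]
  congr 1
  rw [← Finset.sum_filter_add_sum_filter_not Finset.univ (fun w => w ∈ P₀)]
  congr 1
  · -- the places of `P₀`: the Cayley-centre reading (§2)
    rw [Finset.sum_subtype (Finset.univ.filter (fun w => w ∈ P₀)) (p := fun w => w ∈ P₀) (fun w => by simp)]
    refine Finset.sum_congr rfl fun i _ => ?_
    rw [dif_pos i.2, coe_conj_endoBlockAt_eq_smul L S i.1 (hP₀ i.1 i.2) c (m i.1)]
  · -- the other places: the leaf conjugate as a product of matrices
    refine Finset.sum_congr rfl fun w hw => ?_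
    have hw' : w ∉ P₀ := (Finset.mem_filter.1 hw).2
    rw [dif_neg hw', hAB w hw', ← endoBlock_eq_endoBlockAt]
    simp only [Subgroup.coe_mul, Subgroup.coe_inv, Units.val_mul, Matrix.mul_assoc]

end Model

end Literature.NumberTheory.Rogawski1990

end
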